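/-
Copyright: lit-balaban Phase-2 proof seat p08 (gen 7).  Statement-level skeleton of a published paper; no proof claims beyond what
the kernel checks below.
-/
import Literature.MathematicalPhysics.QuantumFieldTheory.BalabanImbrieJaffe1984to88.BIJ85Eq625Torus
import Literature.MathematicalPhysics.QuantumFieldTheory.BalabanImbrieJaffe1984to88.BIJ88Eq215Proof

/-!
# `BalabanImbrieJaffe1984to88.BIJ88Eq215Torus` — T. Bałaban, J. Imbrie, A. Jaffe, *Effective action and cluster properties of the
abelian Higgs model*, Commun. Math. Phys. **114** (1988) 257–315 [BalabanImbrieJaffe1988]: **(2.15)** p. 261,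
`σ_k = Q^e_k(I − ∂G_{k,Ax}∂*)Q^{e*}_k = Q^e_k(I − ∂𝒟_k∂*)Q^{e*}_k` — PROVED OUTRIGHT AT THE TORUS MODEL OF RECORD: for p30's torus form
`σ_k = BIJ85Sigma421Torus.sigmaTorus` ((I.4.2.1)–(I.4.2.2) on the `Setup` tori), with `G_{k,Ax}` = p11's hierarchical sum (I.5.2.2) `GaxE`
(= the functional-integral propagator (I.4.1.1), `BIJ85Eq625Torus.axialPropagator_eq_GaxE`) and `𝒟_k` = (I.4.4.4) `DkE` (Landau minimizers),
the two printed expressions of `σ_k` AGREE as linear operators on unit-lattice plaquette fields — the hypothesis «(I.5.2.6)/(I.5.2.10)» of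
the knitting `BIJ88Eq215Proof` (p02 g2) DISCHARGED by p11's `BIJ85Prop522Torus.eq5210_torus`

statement-level skeleton of published theorems with citation tags; proofs where landed; nothing here is a claim about the Yang–Mills mass gap

PDF held: `paper:balaban1988-cmp114-bij-abelian-higgs-effective-action` (journal page = PDF page + 256), p. 261 [PDF 5] (text layer
`~/.lit/texts/paper-balaban1988-cmp114-bij-abelian-higgs-effective-action/p0005.txt`, re-read this session); (I) = [BalabanImbrieJaffe1985]
(`paper:balaban1985-cmp97-bij-higgs-minimizers`): (4.2.2) p. 310, Prop. 5.2.2 (5.2.6) p. 316, Remark 1 (5.2.10) p. 317.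

CITATION HEADER (lean-in-tree rule).  Part of the lit-balaban TYPED SKELETON (HOME `run/shared/lean/pub/lit-balaban/`), Phase-2 proof
seat p08 (gen 7), unit `lit-balaban-p08`; WHAT IS REPRODUCED = SKELETON row **C2.Eq2.15** of `HOME/SKELETON.md` (reader file
`HOME/lit-balaban-r18/ROWS-C2.md`, owner r18, referee ref-5: *"proved p247379 (p02 g2; knitting identity, C1 inputs displayed)"*), kind
«model instance»: the C1 inputs are now theorems of the tree's torus calculus, so (2.15) holds with NO displayed hypothesis.
TAKING line HOME/STATUS.md 2026-08-21T07:46:43Z.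

THE PRINTED TEXT (p. 261 [PDF 5], verbatim): *"The operator σ_k gives the quadratic form for the k-th-step field strengths
f^{(k)}(p) = (ie_k)^{−1} log u(p). … Recall from [2] that σ_k = Q^e_k(I − ∂G_{k,Ax}∂*)Q^{e*}_k = Q^e_k(I − ∂𝒟_k∂*)Q^{e*}_k, (2.15) the second
equality following from the change of gauge, (I.5.2.6)."*  (I) p. 317: *"Remark 1. A consequence of the proposition is
∂G_{k,Ax}∂* = ∂𝒟_k∂*. (5.2.10)"*.

THE TORUS DATA (all in the tree; standing range `k ≤ m + K` of `Setup`, weight `w = η^d > 0`, lattice factor `c = η⁻¹ ≠ 0`, `2 ≤ d`):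
unit-lattice plaquette fields `UnitPlaqSpace P k`, η-plaquette fields `PlaqSpace P`, η-bond fields `BondSpace P` (Euclidean carriers of
p09/p30); `Q^{e*}_k = QesOp hd w k` (p30), `Q^e_k` = its Hilbert-space adjoint, `∂ = curlOp w c`, `∂* = LinearMap.adjoint (curlOp w c)`;
`σ_k = sigmaTorus hd w c k := Q^e_k(I − ∂G_{k,Ax}∂*)Q^{e*}_k` with `G_{k,Ax} = axialPropagator (V411 P k) ∂` (p09's (I.4.1.1) operator, p30's
torus instance — DEFINED by the first expression of (2.15)); `GaxE P w c k = Σ_{j<k} H_{j,Ax}C^{(j)}H*_{j,Ax}` ((I.5.2.2) verbatim, p11) and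
`DkE P w c k = Σ_{j<k} H_jC^{(j)}H_j*` ((I.4.4.4) verbatim, p11; `H_j` the Landau minimizer (I.4.4.2)).

WHAT IS PROVED (0 `sorry`, standard axioms; theorems only — proof lane):
* §1 `sigmaTorus_eq_GaxE` — the FIRST expression of (2.15) with the hierarchical `G_{k,Ax}` of (I.5.2.2):
  `σ_k = Q^e_k ∘ (I − ∂ ∘ GaxE ∘ ∂*) ∘ Q^{e*}_k` (definition of `sigmaTorus` + `axialPropagator_eq_GaxE`);
* §2 **`eq215_torus`** — THE SECOND EQUALITY OF (2.15) ON THE TORI: `σ_k = Q^e_k ∘ (I − ∂ ∘ 𝒟_k ∘ ∂*) ∘ Q^{e*}_k` with `𝒟_k = DkE`, no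
  hypothesis of printed shape left («the change of gauge (I.5.2.6)» = p11's hypothesis-free `eq5210_torus`); `eq215_torus_apply`
  (configuration form), `inner_sigmaTorus_eq` (the quadratic form: `⟨f, σ_kg⟩ = ⟨Q^{e*}_kf, Q^{e*}_kg⟩ − ⟨∂*Q^{e*}_kf, 𝒟_k∂*Q^{e*}_kg⟩`);
* §3 **`eq215_typed_torus`** — r18's typed ring-level statement `BIJ88Sect2Statements.Eq215` INHABITED at the torus operators placed in the
  one ring `Module.End ℝ (P₁ × P_η × A)` by p02's split-embedding dictionary (`BIJ88Eq215Proof.Slot`/`emb`), for every choice of slots.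
HONEST SCOPE.  One torus at a time (`P`, `k ≤ m + K` fixed); `σ_k` is the operator DEFINED by (I.4.2.2) and PROVED to satisfy the
functional-integral identity (I.4.2.1) in `BIJ85Sigma421Torus.isSigmaForm_sigmaTorus` — nothing here re-derives (I.4.2.1); nothing on the
bounds (2.16)–(2.19).  No `def`, no new named fact; NOT summit progress.
-/

open scoped BigOperators RealInnerProductSpace

namespace Literature.MathematicalPhysics.QuantumFieldTheory.BalabanImbrieJaffe1984to88.BIJ88Eq215Torus

open Literature.MathematicalPhysics.QuantumFieldTheory.Balaban1983to89
open BIJ85AxialPropagator411 BIJ85Prop521Torus BIJ85Sigma421Torus BIJ85Prop522Torus BIJ85Eq625Torus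

noncomputable section

variable {P : Params}

/-! ## §1  The first expression of (2.15) with `G_{k,Ax}` = the hierarchical sum (I.5.2.2) -/

/-- **(2.15), first expression, on the tori**: `σ_k = Q^e_k(I − ∂G_{k,Ax}∂*)Q^{e*}_k` with `G_{k,Ax} = Σ_{j<k} H_{j,Ax}C^{(j)}H*_{j,Ax}`
((I.5.2.2) = (I.4.1.1) on the tori, `BIJ85Eq625Torus.axialPropagator_eq_GaxE`); `k ≤ m + K`, `c ≠ 0`, `w > 0`.
[cite: BalabanImbrieJaffe1988, (2.15) p.261] -/
theorem sigmaTorus_eq_GaxE (hd : 2 ≤ P.d) {k : ℕ} (hk : k ≤ P.m + P.K) {c : ℝ} (hc : c ≠ 0) {w : ℝ} (hw : 0 < w) :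
    sigmaTorus (P := P) hd w c k =
      LinearMap.adjoint (QesOp (P := P) hd w k) ∘ₗ
        (LinearMap.id - curlOp (P := P) w c ∘ₗ GaxE P w c k ∘ₗ LinearMap.adjoint (curlOp (P := P) w c)) ∘ₗ
          QesOp (P := P) hd w k := by
  rw [← axialPropagator_eq_GaxE hc hw hk]
  rfl

/-! ## §2  (2.15): the second equality, «following from the change of gauge, (I.5.2.6)» -/

/-- **(2.15) ON THE TORI** p. 261 [PDF 5], verbatim: *"σ_k = Q^e_k(I − ∂G_{k,Ax}∂*)Q^{e*}_k = Q^e_k(I − ∂𝒟_k∂*)Q^{e*}_k, (2.15) the second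
equality following from the change of gauge, (I.5.2.6)"* — for p30's torus `σ_k` (defined by the first expression, `G_{k,Ax}` = (I.4.1.1))
and p11's `𝒟_k = Σ_{j<k} H_jC^{(j)}H_j*` ((I.4.4.4), Landau minimizers), with NO hypothesis of printed shape: (I.5.2.10)
`∂G_{k,Ax}∂* = ∂𝒟_k∂*` is p11's `BIJ85Prop522Torus.eq5210_torus` (from Proposition I.5.2.2 on the tori); `k ≤ m + K`, `c ≠ 0`, `w > 0`.
[cite: BalabanImbrieJaffe1988, (2.15) p.261] -/
theorem eq215_torus (hd : 2 ≤ P.d) {k : ℕ} (hk : k ≤ P.m + P.K) {c : ℝ} (hc : c ≠ 0) {w : ℝ} (hw : 0 < w) :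
    sigmaTorus (P := P) hd w c k =
      LinearMap.adjoint (QesOp (P := P) hd w k) ∘ₗ
        (LinearMap.id - curlOp (P := P) w c ∘ₗ DkE P w c k ∘ₗ LinearMap.adjoint (curlOp (P := P) w c)) ∘ₗ
          QesOp (P := P) hd w k := by
  rw [sigmaTorus_eq_GaxE hd hk hc hw, eq5210_torus hk hc hw]

/-- (2.15) on the tori, both printed expressions side by side: `Q^e_k(I − ∂G_{k,Ax}∂*)Q^{e*}_k = Q^e_k(I − ∂𝒟_k∂*)Q^{e*}_k` as operators on
unit-lattice plaquette fields (`G_{k,Ax} = GaxE`, `𝒟_k = DkE`). [cite: BalabanImbrieJaffe1988, (2.15) p.261] -/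
theorem eq215_torus_GaxE_DkE (hd : 2 ≤ P.d) {k : ℕ} (hk : k ≤ P.m + P.K) {c : ℝ} (hc : c ≠ 0) {w : ℝ} (hw : 0 < w) :
    LinearMap.adjoint (QesOp (P := P) hd w k) ∘ₗ
        (LinearMap.id - curlOp (P := P) w c ∘ₗ GaxE P w c k ∘ₗ LinearMap.adjoint (curlOp (P := P) w c)) ∘ₗ
          QesOp (P := P) hd w k =
      LinearMap.adjoint (QesOp (P := P) hd w k) ∘ₗ
        (LinearMap.id - curlOp (P := P) w c ∘ₗ DkE P w c k ∘ₗ LinearMap.adjoint (curlOp (P := P) w c)) ∘ₗ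
          QesOp (P := P) hd w k := by
  rw [← sigmaTorus_eq_GaxE hd hk hc hw, eq215_torus hd hk hc hw]

/-- (2.15) on the tori, configuration form: `σ_kf = Q^e_k(Q^{e*}_kf − ∂𝒟_k∂*Q^{e*}_kf)` for every unit-lattice plaquette field `f`.
[cite: BalabanImbrieJaffe1988, (2.15) p.261] -/
theorem eq215_torus_apply (hd : 2 ≤ P.d) {k : ℕ} (hk : k ≤ P.m + P.K) {c : ℝ} (hc : c ≠ 0) {w : ℝ} (hw : 0 < w)
    (f : UnitPlaqSpace P k) :
    sigmaTorus (P := P) hd w c k f =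
      LinearMap.adjoint (QesOp (P := P) hd w k)
        (QesOp (P := P) hd w k f -
          curlOp (P := P) w c (DkE P w c k (LinearMap.adjoint (curlOp (P := P) w c) (QesOp (P := P) hd w k f)))) := by
  rw [eq215_torus hd hk hc hw]
  simp only [LinearMap.coe_comp, Function.comp_apply, LinearMap.sub_apply, LinearMap.id_apply]

/-- (2.15) on the tori as a quadratic form (the shape in which σ_k «gives the quadratic form for the k-th-step field strengths»):
`⟨f, σ_kg⟩ = ⟨Q^{e*}_kf, Q^{e*}_kg⟩_η − ⟨∂*Q^{e*}_kf, 𝒟_k∂*Q^{e*}_kg⟩_η`. [cite: BalabanImbrieJaffe1988, (2.15) p.261] -/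
theorem inner_sigmaTorus_eq (hd : 2 ≤ P.d) {k : ℕ} (hk : k ≤ P.m + P.K) {c : ℝ} (hc : c ≠ 0) {w : ℝ} (hw : 0 < w)
    (f g : UnitPlaqSpace P k) :
    ⟪f, sigmaTorus (P := P) hd w c k g⟫ =
      ⟪QesOp (P := P) hd w k f, QesOp (P := P) hd w k g⟫ -
        ⟪LinearMap.adjoint (curlOp (P := P) w c) (QesOp (P := P) hd w k f),
          DkE P w c k (LinearMap.adjoint (curlOp (P := P) w c) (QesOp (P := P) hd w k g))⟫ := by
  rw [eq215_torus_apply hd hk hc hw, LinearMap.adjoint_inner_right, inner_sub_right, LinearMap.adjoint_inner_left]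

/-! ## §3  r18's typed `Eq215` inhabited at the torus operators (p02's one-ring dictionary) -/

/-- **row C2.Eq2.15's typed statement `BIJ88Sect2Statements.Eq215` HOLDS for the torus operators** placed in one ring `Module.End ℝ V`
by ANY split embeddings (p02's `BIJ88Eq215Proof.Slot`/`emb`) of the three spaces `P₁ = UnitPlaqSpace P k`, `P_η = PlaqSpace P`,
`A = BondSpace P` into a common carrier `V`: `Eq215 Q^e Q^{e*} ∂ ∂* G_{k,Ax} 𝒟_k` with `Q^e_k = (QesOp)^*`, `Q^{e*}_k = QesOp`,
`∂ = curlOp`, `∂* = (curlOp)^*`, `G_{k,Ax} = GaxE`, `𝒟_k = DkE` — p02's `eq215_emb` fed with the torus theorem (I.5.2.10) `eq5210_torus`.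
[cite: BalabanImbrieJaffe1988, (2.15) p.261] -/
theorem eq215_typed_torus (hd : 2 ≤ P.d) {k : ℕ} (hk : k ≤ P.m + P.K) {c : ℝ} (hc : c ≠ 0) {w : ℝ} (hw : 0 < w)
    {V : Type} [AddCommGroup V] [Module ℝ V]
    (s₁ : BIJ88Eq215Proof.Slot (𝕜 := ℝ) (UnitPlaqSpace P k) V) (sη : BIJ88Eq215Proof.Slot (𝕜 := ℝ) (PlaqSpace P) V)
    (sA : BIJ88Eq215Proof.Slot (𝕜 := ℝ) (BondSpace P) V) :
    BIJ88Sect2Statements.Eq215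
      (BIJ88Eq215Proof.emb s₁ sη (LinearMap.adjoint (QesOp (P := P) hd w k)))
      (BIJ88Eq215Proof.emb sη s₁ (QesOp (P := P) hd w k))
      (BIJ88Eq215Proof.emb sη sA (curlOp (P := P) w c))
      (BIJ88Eq215Proof.emb sA sη (LinearMap.adjoint (curlOp (P := P) w c)))
      (BIJ88Eq215Proof.emb sA sA (GaxE P w c k))
      (BIJ88Eq215Proof.emb sA sA (DkE P w c k)) :=
  BIJ88Eq215Proof.eq215_emb s₁ sη sA _ _ _ _ _ _ (eq5210_torus hk hc hw)

/-- The same on the CANONICAL common carrier `V = P₁ × (P_η × A)` (product slots `Slot.inl`, `Slot.inr ∘ Slot.inl`, `Slot.inr ∘ Slot.inr`):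
r18's `Eq215` inhabited with no choice left. [cite: BalabanImbrieJaffe1988, (2.15) p.261] -/
theorem eq215_typed_torus_prod (hd : 2 ≤ P.d) {k : ℕ} (hk : k ≤ P.m + P.K) {c : ℝ} (hc : c ≠ 0) {w : ℝ} (hw : 0 < w) :
    let s₁ := BIJ88Eq215Proof.Slot.inl (𝕜 := ℝ) (UnitPlaqSpace P k) (PlaqSpace P × BondSpace P)
    let s₂ := BIJ88Eq215Proof.Slot.inr (𝕜 := ℝ) (UnitPlaqSpace P k) (PlaqSpace P × BondSpace P)
    let sη := s₂.comp (BIJ88Eq215Proof.Slot.inl (𝕜 := ℝ) (PlaqSpace P) (BondSpace P))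
    let sA := s₂.comp (BIJ88Eq215Proof.Slot.inr (𝕜 := ℝ) (PlaqSpace P) (BondSpace P))
    BIJ88Sect2Statements.Eq215
      (BIJ88Eq215Proof.emb s₁ sη (LinearMap.adjoint (QesOp (P := P) hd w k)))
      (BIJ88Eq215Proof.emb sη s₁ (QesOp (P := P) hd w k))
      (BIJ88Eq215Proof.emb sη sA (curlOp (P := P) w c))
      (BIJ88Eq215Proof.emb sA sη (LinearMap.adjoint (curlOp (P := P) w c)))
      (BIJ88Eq215Proof.emb sA sA (GaxE P w c k))
      (BIJ88Eq215Proof.emb sA sA (DkE P w c k)) :=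
  eq215_typed_torus hd hk hc hw _ _ _

end

end Literature.MathematicalPhysics.QuantumFieldTheory.BalabanImbrieJaffe1984to88.BIJ88Eq215Torus
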